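import Literature.AnabelianGeometry.AbsoluteAnabelian.LocalBrauerGroupQmodZ
import Literature.AnabelianGeometry.AbsoluteAnabelian.LocalResidueMapRestriction
import Literature.NumberTheory.GaloisRepresentations.CyclicClassRestrict
import Literature.NumberTheory.GaloisRepresentations.LocalWeilDatumValuation
import HarnessLib

/-!
# The local invariant of an unramified cyclic class: `inv_F (χ, b) = v(b) · χ(Frob)`
# (Serre, *Local Fields* XIII §4 Prop. 13, XIV §1 Prop. 3 — unramified case)

Topic `NumberTheory/GaloisCohomology`; namespace `Literature.NumberTheory.GaloisCohomology`.  Proof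
file (theorems only: no definition, no named fact, no instance; D-0026) for the (F1) campaign of cell
`bsd-cn100` (Poitou–Tate `poitouTate_sum_localTatePairing_eq_zero` on THE pinned family
`LocalInvariants.canonical`, node F-a "unramified evaluation formula" of `F1-SUPPLY-MAP-g5.md` §5):
the value of THE local invariant map on the local components of a global cyclic class at the places
where the character is unramified.

For a non-archimedean local field `F` of characteristic `0` (valued form), `n ≥ 1`, THE residue map
`inv_n = Prop121vii.invLevel F n : H²(Γ_F, μ_n) ⥲ ℤ/n` (characterised by `IsInvariantMap`:
bijective, `inv_n (κ_n(π) ∪ χ₁) = 1` for a uniformiser `π` and THE unramified character `χ₁` with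
`χ₁(Frob) = 1`) and the Brauer invariant `inv_F = Prop121vii.brauerInvariantEquiv F : H²(Γ_F, F̄ˣ) ⥲ ℚ/ℤ`:

* `cyclicCharacter_eq_mul_of_unramified` — an unramified character `θ : Γ_F → ℤ/n` (killing the
  inertia group) is `θ = θ(φ) · χ₁` for every Frobenius lift `φ` (Weil density: `Γ_F/I_F` is
  topologically generated by Frobenius);
* `invLevel_cupProduct_kummer_scalarCocycle_of_unramified` — **`inv_n (κ_n(x) ∪ θ) = v(x) · θ(φ)`**
  in `ℤ/n` for every `x ∈ Fˣ` and unramified `θ` (`κ_n` the Kummer class, `∪` the tree's cup product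
  `H¹(μ_n) × H¹(μ_n^∨(1)) → H²(μ_n)`, `θ` read as the crossed homomorphism `σ ↦ θ(σ)·id`):
  write `x = u π^{v(x)}`; units give `0` (units are norms from the unramified extension, the tree's
  `exists_normalizedCharacter` (b)), the uniformiser gives `1` (normalisation of `inv_n`);
* `cupProduct_kummer_scalarCocycle_eq_zero_of_unit`, `cyclicClass_eq_zero_of_unramified_of_unit` —
  for a unit `x` and unramified `θ` the classes `κ_n(x) ∪ θ ∈ H²(Γ_F, μ_n)` and
  `(θ, x) ∈ H²(Γ_F, F̄ˣ)` VANISH;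
* `brauerInvariantEquiv_cyclicClass_of_unramified` — **`inv_F (θ, x) = −v(x)·θ(φ)/n ∈ ℚ/ℤ`** for the
  tree's cyclic class `cyclicClass θ (units F) x = [c_θ ⊗ x]` (the sign is the tree's:
  `Kummer (κ_n(x) ∪ θ) = −(θ, x)`, `cohomologyMap_kummerι_cupProduct_δ₀_scalar`);
* `brauerInvariantEquiv_cyclicClass_derived_of_unramified` — the same for the DERIVED character
  `χ.derived ρ` of a character `χ : G → ℤ/d` of any topological group along `ρ : Γ_F → G` with
  `χ ∘ ρ` unramified: `inv_F (χ.derived ρ, x) = −v(x)·χ(ρ φ)/d` — the shape met when a GLOBAL cyclic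
  class `(χ, b)`, `χ` a character of `Γ_K`, is localised at a finite place `v ∤ 𝔣_χ` of a number field
  (`map_cyclicClass_eq_cyclicClass_derived`): its local invariant is `−ord_v(b)·χ(Frob_v)/d`.

These are the local terms of the reciprocity law `∑_v inv_v = 0` at the unramified places
(Tate, Cassels–Fröhlich VII §11; Milne ADT I App. A).  HONEST FRAMING: classical local class field
theory over the tree's continuous cohomology; infrastructure for Poitou–Tate; proves no case of BSD.

## References

* J.-P. Serre, *Local Fields*, GTM 67 (1979), XIII §4 Prop. 13, XIV §1 Prop. 2–3.
  [SerreLocalFields1979]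
* J. W. S. Cassels, A. Fröhlich (eds.), *Algebraic Number Theory* (1967), Ch. VI §1.1 (Serre,
  `inv(χ, b)`), Ch. VII §11. [CasselsFrohlichANT1967]
-/

noncomputable section

universe u

namespace Literature.NumberTheory.GaloisCohomology

open Field Function CategoryTheory
open Literature.NumberTheory.GaloisRepresentations
open Literature.NumberTheory.GaloisRepresentations.DiscreteGaloisModule
open Literature.NumberTheory.GaloisRepresentations.LocalWeilDatum
open Literature.NumberTheory.GaloisRepresentations.IsNonarchimedeanLocalField
open Literature.AnabelianGeometry.AbsoluteAnabelian
open Literature.AnabelianGeometry.AbsoluteAnabelian.Prop121vii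
open ValuativeRel

/-! ### §1. Unramified characters are multiples of the normalised one -/

section Characters

variable (F : Type u) [Field F] [ValuativeRel F] [TopologicalSpace F] [IsNonarchimedeanLocalField F]
  {n : ℕ}

/-- **An unramified character is a multiple of the normalised unramified character**: if
`θ, χ₁ : Γ_F → ℤ/n` kill the inertia group and `χ₁ = 1` on every arithmetic-Frobenius lift, then
`θ(σ) = θ(φ) · χ₁(σ)` for all `σ` and every Frobenius lift `φ` (the difference is a continuous
homomorphism with open kernel containing `I_F` and a Frobenius, trivial by Weil density,
`range_eq_zpowers_of_absInertia_le_ker`). [cite: SerreLocalFields1979, XIII §4 Prop. 13] -/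
theorem cyclicCharacter_eq_mul_of_unramified (θ χ₁ : CyclicCharacter (absoluteGaloisGroup F) n)
    (hIθ : ∀ σ ∈ absInertia F, θ σ = 0) (hI : ∀ σ ∈ absInertia F, χ₁ σ = 0)
    (hF : ∀ σ : absoluteGaloisGroup F, IsFrobPow σ 1 → χ₁ σ = 1)
    {φ : absoluteGaloisGroup F} (hφ : IsFrobPow φ 1) (σ : absoluteGaloisGroup F) :
    θ σ = θ φ * χ₁ σ := by
  let d : absoluteGaloisGroup F →* Multiplicative (ZMod n) :=
    { toFun := fun τ => Multiplicative.ofAdd (θ τ - θ φ * χ₁ τ)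
      map_one' := by rw [θ.map_one, χ₁.map_one, mul_zero, sub_zero]; rfl
      map_mul' := fun τ τ' => by
        rw [← ofAdd_add, θ.map_mul, χ₁.map_mul]
        congr 1
        ring }
  have hd : ∀ τ, d τ = Multiplicative.ofAdd (θ τ - θ φ * χ₁ τ) := fun τ => rfl
  have hcont : Continuous fun τ : absoluteGaloisGroup F => θ τ - θ φ * χ₁ τ := by
    have h1 : Continuous fun τ : absoluteGaloisGroup F => (θ τ, χ₁ τ) :=
      θ.continuous.prodMk χ₁.continuous
    exact (continuous_of_discreteTopology
      (f := fun p : ZMod n × ZMod n => p.1 - θ φ * p.2)).comp h1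
  have hker : (d.ker : Set (absoluteGaloisGroup F)) = (fun τ => θ τ - θ φ * χ₁ τ) ⁻¹' {0} := by
    ext τ
    simp only [SetLike.mem_coe, MonoidHom.mem_ker, Set.mem_preimage, Set.mem_singleton_iff, hd]
    exact ⟨fun h => Multiplicative.ofAdd.injective (h.trans ofAdd_zero.symm),
      fun h => by rw [h, ofAdd_zero]⟩
  have hopen : IsOpen ((d.ker : Subgroup _) : Set (absoluteGaloisGroup F)) := by
    rw [hker]
    exact (isOpen_discrete _).preimage hcont
  have hIker : absInertia F ≤ d.ker := fun τ hτ => by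
    rw [MonoidHom.mem_ker, hd, hIθ τ hτ, hI τ hτ, mul_zero, sub_zero, ofAdd_zero]
  obtain ⟨φ₀, hφ₀⟩ := exists_isAbsArithFrob_holds F
  have hφ₀1 : IsFrobPow φ₀ 1 := IsAbsArithFrob.isFrobPow_holds hφ₀
  have hθφ : θ φ₀ = θ φ := by
    have hmem : φ * φ₀⁻¹ ∈ absInertia F := IsFrobPow.mul_inv_mem_absInertia_holds hφ hφ₀1
    have h0 := hIθ _ hmem
    rw [θ.map_mul, θ.map_inv, ← sub_eq_add_neg, sub_eq_zero] at h0
    exact h0.symm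
  have hdφ : d φ₀ = 1 := by
    rw [hd, hF φ₀ hφ₀1, mul_one, hθφ, sub_self, ofAdd_zero]
  have hrange := IsNonarchimedeanLocalField.range_eq_zpowers_of_absInertia_le_ker d hopen hIker hφ₀
  rw [hdφ, Subgroup.zpowers_one_eq_bot] at hrange
  have hσ : d σ ∈ d.range := ⟨σ, rfl⟩
  rw [hrange, Subgroup.mem_bot, hd] at hσ
  exact sub_eq_zero.1 (Multiplicative.ofAdd.injective (hσ.trans ofAdd_zero.symm))

/-- An unramified character takes the same value on all Frobenius lifts. [cite: SerreLocalFields1979, XIII §4 Prop. 13] -/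
theorem cyclicCharacter_apply_eq_of_isFrobPow_one (θ : CyclicCharacter (absoluteGaloisGroup F) n)
    (hIθ : ∀ σ ∈ absInertia F, θ σ = 0) {φ φ' : absoluteGaloisGroup F} (hφ : IsFrobPow φ 1)
    (hφ' : IsFrobPow φ' 1) : θ φ = θ φ' := by
  have hmem : φ * φ'⁻¹ ∈ absInertia F := IsFrobPow.mul_inv_mem_absInertia_holds hφ hφ'
  have h0 := hIθ _ hmem
  rw [θ.map_mul, θ.map_inv, ← sub_eq_add_neg, sub_eq_zero] at h0
  exact h0

omit [ValuativeRel F] [TopologicalSpace F] [IsNonarchimedeanLocalField F] in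
/-- Reduction modulo `n` of a product acting on an `n`-torsion element. [folklore] -/
private theorem val_mul_zsmul_of_torsion {M : Type*} [AddCommGroup M] [NeZero n] (a b : ZMod n)
    (m : M) (hm : (n : ℤ) • m = 0) :
    (((a * b).val : ℤ)) • m = a.val • ((((b.val : ℤ)) • m)) := by
  have hs : (a.val * b.val : ℕ) = (a * b).val + n * ((a.val * b.val) / n) := by
    rw [ZMod.val_mul, Nat.mod_add_div]
  have hz : ((a.val : ℤ)) * ((b.val : ℤ)) =
      (((a * b).val : ℤ)) + (((a.val * b.val) / n : ℕ) : ℤ) * (n : ℤ) := by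
    rw [mul_comm (((a.val * b.val) / n : ℕ) : ℤ)]; exact_mod_cast hs
  rw [← natCast_zsmul, ← mul_smul, hz, add_smul, mul_smul, hm, smul_zero, add_zero]

omit [ValuativeRel F] [TopologicalSpace F] [IsNonarchimedeanLocalField F] in
/-- **The crossed homomorphism of `t · χ` is `t` times that of `χ`**: if `θ = t · χ` pointwise then
`scalarCocycle θ = t.val • scalarCocycle χ` in `Z¹(Γ_F, μ_n^∨(1))`. [cite: SerreLocalFields1979, XIV §1] -/
theorem scalarCocycle_eq_nsmul [NeZero n] (θ χ : CyclicCharacter (absoluteGaloisGroup F) n)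
    (t : ZMod n) (h : ∀ σ, θ σ = t * χ σ) :
    scalarCocycle θ = t.val • scalarCocycle χ := by
  refine Subtype.ext (ContinuousMap.ext fun σ => TateDual.ext fun m => ?_)
  change (scalarCocycle θ).1 σ m = t.val • ((scalarCocycle χ).1 σ m)
  rw [scalarCocycle_apply, h σ, scalarCocycle_apply]
  exact val_mul_zsmul_of_torsion t (χ σ) _
    (by rw [← map_zsmul, zsmul_muCarrier_eq_zero, map_zero])

end Characters

/-! ### §2. The invariant of `κ_n(x) ∪ θ` for an unramified `θ` -/

section Invariant

variable (F : Type u) [Field F] [ValuativeRel F] [TopologicalSpace F] [IsNonarchimedeanLocalField F]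
  [CharZero F] {n : ℕ} [NeZero n]

omit [ValuativeRel F] [TopologicalSpace F] [IsNonarchimedeanLocalField F] [CharZero F] [NeZero n] in
/-- `baseUnitsInvariant` only depends on the element. [folklore] -/
private theorem baseUnitsInvariant_congr {x y : F} (hx : x ≠ 0) (hy : y ≠ 0) (h : x = y) :
    baseUnitsInvariant F x hx = baseUnitsInvariant F y hy := by
  subst h
  rfl

/-- **`inv_n (κ_n(x) ∪ θ) = v(x) · θ(φ)` for an unramified character `θ`** (`x ∈ Fˣ`, `v = ord_F`,
`φ` any Frobenius lift; `κ_n(x) = δ₀(x)` the Kummer class, `∪` the cup product for the evaluation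
pairing `μ_n × μ_n^∨(1) → μ_n`, `inv_n` THE residue map `invLevel`).  Proof: `θ = θ(φ)·χ₁`
(`cyclicCharacter_eq_mul_of_unramified`), so `κ_n(x) ∪ θ = θ(φ) · (κ_n(x) ∪ χ₁)`; with
`x = u · π^{v(x)}`, `κ_n(u) ∪ χ₁ = 0` (units are norms from the unramified extension:
`exists_normalizedCharacter` (b) with `cohomologyMap_kummerι_cupProduct_δ₀_scalar` and the
injectivity of `H²(μ_n) → H²(F̄ˣ)`), and `inv_n (κ_n(π) ∪ χ₁) = 1` (`isInvariantMap_invLevel`).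
[cite: SerreLocalFields1979, XIII §4 Prop. 13; XIV §1 Prop. 3] -/
theorem invLevel_cupProduct_kummer_scalarCocycle_of_unramified
    (θ : CyclicCharacter (absoluteGaloisGroup F) n) (hIθ : ∀ σ ∈ absInertia F, θ σ = 0)
    {φ : absoluteGaloisGroup F} (hφ : IsFrobPow φ 1) (x : F) (hx : x ≠ 0) :
    haveI : CompactSpace (absoluteGaloisGroup F) := absoluteGaloisGroup_compactSpace F
    invLevel F n (((mu F n).tateDualPairing n).cupProduct
        ((isSES_kummer F n (NeZero.pos n)).δ₀ (baseUnitsInvariant F x hx))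
        (oneCocycleClass _ (scalarCocycle θ))) = ((ord F x : ℤ) : ZMod n) * θ φ := by
  classical
  haveI : CompactSpace (absoluteGaloisGroup F) := absoluteGaloisGroup_compactSpace F
  rcases Nat.lt_or_ge 1 n with hn1 | hn1
  swap
  · have hn : n = 1 := le_antisymm hn1 (NeZero.pos n)
    subst hn
    exact Subsingleton.elim _ _
  -- THE normalised unramified character and its two class-field-theoretic properties
  obtain ⟨χ₁, hI1, hF1, -, hunit⟩ := exists_normalizedCharacter F n hn1
  have hg1 : IsNormalizedUnramifiedCocycle F n (scalarCocycle χ₁) :=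
    isNormalizedUnramifiedCocycle_scalarCocycle F χ₁ hI1 hF1
  have hθ : ∀ σ, θ σ = θ φ * χ₁ σ :=
    cyclicCharacter_eq_mul_of_unramified F θ χ₁ hIθ hI1 hF1 hφ
  have hcoc : scalarCocycle θ = (θ φ).val • scalarCocycle χ₁ :=
    scalarCocycle_eq_nsmul F θ χ₁ (θ φ) hθ
  -- a uniformiser
  obtain ⟨ϖ, hϖ⟩ := IsDiscreteValuationRing.exists_irreducible 𝒪[F]
  have hπ0 : (ϖ : F) ≠ 0 := fun h => hϖ.ne_zero (Subtype.ext h)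
  have hπ : (valuation F).IsUniformizer (ϖ : F) :=
    (ord_eq_one_iff F hπ0).1 (ord_eq_one_of_irreducible F hϖ)
  -- carrier-typed aliases (all bookkeeping is additive, on Mathlib's carriers)
  let ι : continuousCohomology 2 (mu F n).toTopRep →+ ZMod n := invLevel F n
  let P := (mu F n).tateDualPairing n
  let c₁ := oneCocycleClassₗ ((mu F n).tateDual n).toTopRep
  let g₁ := c₁ (scalarCocycle χ₁)
  let δ := (isSES_kummer F n (NeZero.pos n)).δ₀
  have hadd : ∀ a b : continuousCohomology 1 (mu F n).toTopRep,
      P.cupProduct (a + b) g₁ = P.cupProduct a g₁ + P.cupProduct b g₁ := fun a b => by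
    rw [map_add, LinearMap.add_apply]
  have hsucc : ∀ (m : ℕ) (w : (units F).toTopRep.ρ.invariants),
      (((m + 1 : ℕ) : ℤ)) • w = ((m : ℤ)) • w + w := fun m w => by
    rw [Nat.cast_succ, add_smul, one_smul]
  -- units: `κ_n(u) ∪ χ₁ = 0`
  have hunit0 : ∀ (v : F) (hv0 : v ≠ 0), valuation F v = 1 →
      P.cupProduct (δ (baseUnitsInvariant F v hv0)) g₁ = 0 := by
    intro v hv0 hv1
    have h := cohomologyMap_kummerι_cupProduct_δ₀_scalar χ₁ (scalarCocycle χ₁) (scalarCocycle_apply χ₁)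
      (baseUnitsInvariant F v hv0)
    rw [hunit v hv0 hv1 _ (coe_unitsVal_baseUnitsInvariant F v hv0), neg_zero] at h
    exact (kummerTwoOntoTorsion_holds F n).1 (h.trans (map_zero _).symm)
  -- the uniformiser: `inv_n (κ_n(π) ∪ χ₁) = 1`
  have hone : ι (P.cupProduct (δ (baseUnitsInvariant F (ϖ : F) hπ0)) g₁) = 1 :=
    (isInvariantMap_invLevel F n).2 (scalarCocycle χ₁) hg1 (ϖ : F) hπ (baseUnitsInvariant F (ϖ : F) hπ0)
      (coe_unitsVal_baseUnitsInvariant F _ hπ0)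
  have hone' : ∀ m : ℕ, ι (P.cupProduct (δ (((m : ℤ)) • baseUnitsInvariant F (ϖ : F) hπ0)) g₁) =
      (m : ZMod n) := by
    intro m
    induction m with
    | zero =>
      rw [Nat.cast_zero, zero_smul, map_zero δ, map_zero P.cupProduct, LinearMap.zero_apply, map_zero ι,
        Nat.cast_zero]
    | succ m ih => rw [hsucc, map_add δ, hadd, map_add ι, ih, hone, Nat.cast_succ]
  -- `inv_n (κ_n(x) ∪ χ₁) = ord x`: split `ord x = m` or `ord x = -m`
  have hmain : ι (P.cupProduct (δ (baseUnitsInvariant F x hx)) g₁) = ((ord F x : ℤ) : ZMod n) := by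
    obtain ⟨m, hm | hm⟩ := Int.eq_nat_or_neg (ord F x)
    · -- `x = v π^m` with `v` a unit
      have hv0 : x / (ϖ : F) ^ m ≠ 0 := div_ne_zero hx (pow_ne_zero _ hπ0)
      have hv1 : valuation F (x / (ϖ : F) ^ m) = 1 := by
        rw [← ord_eq_zero_iff F hv0, ord_div F hx (pow_ne_zero _ hπ0), ord_pow F hπ0, hm,
          ord_eq_one_of_irreducible F hϖ]
        ring
      have hvx : x / (ϖ : F) ^ m * (ϖ : F) ^ m = x := div_mul_cancel₀ _ (pow_ne_zero _ hπ0)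
      have hbx : baseUnitsInvariant F x hx =
          baseUnitsInvariant F (x / (ϖ : F) ^ m) hv0 + ((m : ℤ)) • baseUnitsInvariant F (ϖ : F) hπ0 := by
        rw [← baseUnitsInvariant_pow, ← baseUnitsInvariant_mul]
        exact baseUnitsInvariant_congr F hx _ hvx.symm
      rw [hbx, map_add δ, hadd, map_add ι, hunit0 _ hv0 hv1, map_zero ι, zero_add, hone', hm,
        Int.cast_natCast]
    · -- `x π^m = v` is a unit
      have hv0 : x * (ϖ : F) ^ m ≠ 0 := mul_ne_zero hx (pow_ne_zero _ hπ0)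
      have hv1 : valuation F (x * (ϖ : F) ^ m) = 1 := by
        rw [← ord_eq_zero_iff F hv0, ord_mul F hx (pow_ne_zero _ hπ0), ord_pow F hπ0, hm,
          ord_eq_one_of_irreducible F hϖ]
        ring
      have hbv : baseUnitsInvariant F (x * (ϖ : F) ^ m) hv0 =
          baseUnitsInvariant F x hx + ((m : ℤ)) • baseUnitsInvariant F (ϖ : F) hπ0 := by
        rw [← baseUnitsInvariant_pow, ← baseUnitsInvariant_mul]
      have h := hunit0 _ hv0 hv1
      rw [hbv, map_add δ, hadd] at h
      have h' := congrArg ι h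
      rw [map_add ι, hone', map_zero ι, add_eq_zero_iff_eq_neg] at h'
      rw [h', hm, Int.cast_neg, Int.cast_natCast]
  -- `κ_n(x) ∪ (m • χ₁)` for all `m`
  have hmul : ∀ m : ℕ, ι (P.cupProduct (δ (baseUnitsInvariant F x hx)) (c₁ (m • scalarCocycle χ₁))) =
      (m : ZMod n) * ((ord F x : ℤ) : ZMod n) := by
    intro m
    induction m with
    | zero =>
      rw [zero_smul, map_zero c₁, map_zero (P.cupProduct _), map_zero ι, Nat.cast_zero, zero_mul]
    | succ m ih =>
      rw [succ_nsmul, map_add c₁, map_add (P.cupProduct _), map_add ι, ih, hmain, Nat.cast_succ,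
        add_mul, one_mul]
  -- assemble: `κ_n(x) ∪ θ = θ(φ) · (κ_n(x) ∪ χ₁)`
  change ι (P.cupProduct (δ (baseUnitsInvariant F x hx)) (c₁ (scalarCocycle θ))) = _
  rw [hcoc, hmul, ZMod.natCast_zmod_val, mul_comm]

/-- **`κ_n(u) ∪ θ = 0` for a unit `u` and an unramified `θ`** (the class itself vanishes in
`H²(Γ_F, μ_n)`: `θ = θ(φ)·χ₁` and `κ_n(u) ∪ χ₁ = 0`, units being norms from the unramified
extension of degree `n`). [cite: SerreLocalFields1979, XIII §4 Prop. 13; V §2] -/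
theorem cupProduct_kummer_scalarCocycle_eq_zero_of_unit
    (θ : CyclicCharacter (absoluteGaloisGroup F) n) (hIθ : ∀ σ ∈ absInertia F, θ σ = 0)
    (x : F) (hx : x ≠ 0) (hx1 : valuation F x = 1) :
    haveI : CompactSpace (absoluteGaloisGroup F) := absoluteGaloisGroup_compactSpace F
    ((mu F n).tateDualPairing n).cupProduct
        ((isSES_kummer F n (NeZero.pos n)).δ₀ (baseUnitsInvariant F x hx))
        (oneCocycleClass _ (scalarCocycle θ)) = 0 := by
  classical
  haveI : CompactSpace (absoluteGaloisGroup F) := absoluteGaloisGroup_compactSpace F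
  rcases Nat.lt_or_ge 1 n with hn1 | hn1
  swap
  · -- `n = 1`: `inv_1` is injective into the trivial group
    have hn : n = 1 := le_antisymm hn1 (NeZero.pos n)
    subst hn
    exact (isInvariantMap_invLevel F 1).1.1 (Subsingleton.elim _ _)
  obtain ⟨χ₁, hI1, hF1, -, hunit⟩ := exists_normalizedCharacter F n hn1
  obtain ⟨φ, hφ⟩ := exists_isAbsArithFrob_holds F
  have hφ1 : IsFrobPow φ 1 := IsAbsArithFrob.isFrobPow_holds hφ
  have hcoc : scalarCocycle θ = (θ φ).val • scalarCocycle χ₁ :=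
    scalarCocycle_eq_nsmul F θ χ₁ (θ φ) (cyclicCharacter_eq_mul_of_unramified F θ χ₁ hIθ hI1 hF1 hφ1)
  have h := cohomologyMap_kummerι_cupProduct_δ₀_scalar χ₁ (scalarCocycle χ₁) (scalarCocycle_apply χ₁)
    (baseUnitsInvariant F x hx)
  rw [hunit x hx hx1 _ (coe_unitsVal_baseUnitsInvariant F x hx), neg_zero] at h
  have h0 := (kummerTwoOntoTorsion_holds F n).1 (h.trans (map_zero _).symm)
  let P := (mu F n).tateDualPairing n
  let c₁ := oneCocycleClassₗ ((mu F n).tateDual n).toTopRep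
  let δ := (isSES_kummer F n (NeZero.pos n)).δ₀
  change P.cupProduct (δ (baseUnitsInvariant F x hx)) (c₁ (scalarCocycle χ₁)) = 0 at h0
  change P.cupProduct (δ (baseUnitsInvariant F x hx)) (c₁ (scalarCocycle θ)) = 0
  rw [hcoc, map_nsmul c₁, map_nsmul (P.cupProduct _), h0, nsmul_zero]

/-- **`(θ, u) = 0` in `H²(Γ_F, F̄ˣ)` for a unit `u` and an unramified `θ`** (the tree's cyclic class
`cyclicClass θ (units F) u`; `Kummer (κ_n(u) ∪ θ) = −(θ, u)`). [cite: SerreLocalFields1979, XIII §4 Prop. 13; V §2] -/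
theorem cyclicClass_eq_zero_of_unramified_of_unit
    (θ : CyclicCharacter (absoluteGaloisGroup F) n) (hIθ : ∀ σ ∈ absInertia F, θ σ = 0)
    (x : F) (hx : x ≠ 0) (hx1 : valuation F x = 1) :
    haveI : CompactSpace (absoluteGaloisGroup F) := absoluteGaloisGroup_compactSpace F
    cyclicClass θ (units F) (baseUnitsInvariant F x hx) = 0 := by
  haveI : CompactSpace (absoluteGaloisGroup F) := absoluteGaloisGroup_compactSpace F
  have h := cohomologyMap_kummerι_cupProduct_δ₀_scalar θ (scalarCocycle θ) (scalarCocycle_apply θ)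
    (baseUnitsInvariant F x hx)
  rw [cupProduct_kummer_scalarCocycle_eq_zero_of_unit F θ hIθ x hx hx1, map_zero] at h
  exact neg_eq_zero.1 h.symm

omit [ValuativeRel F] [TopologicalSpace F] [IsNonarchimedeanLocalField F] [CharZero F] in
/-- `zmodToQmodZ n` on the class of an integer: `k ↦ k/n` (the embedding `(1/n)ℤ/ℤ ⊆ ℚ/ℤ` in which
the level-`n` invariants are read). [cite: SerreLocalFields1979, XIII §3 (`inv_K : Br(K) → ℚ/ℤ`, `H²(K_n/K) ≅ (1/n)ℤ/ℤ`)] -/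
theorem zmodToQmodZ_intCast (k : ℤ) :
    zmodToQmodZ n ((k : ZMod n)) = ((((k : ℚ)) / n : ℚ) : AddCircle (1 : ℚ)) := by
  rw [zmodToQmodZ, ZMod.lift_coe]
  rfl

omit [ValuativeRel F] [TopologicalSpace F] [IsNonarchimedeanLocalField F] [CharZero F] in
/-- `zmodToQmodZ n (k · t) = k · t.val / n` in `ℚ/ℤ` (reading a product of level-`n` invariants in
`(1/n)ℤ/ℤ ⊆ ℚ/ℤ`). [cite: SerreLocalFields1979, XIII §3 (`inv_K : Br(K) → ℚ/ℤ`, `H²(K_n/K) ≅ (1/n)ℤ/ℤ`)] -/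
theorem zmodToQmodZ_intCast_mul (k : ℤ) (t : ZMod n) :
    zmodToQmodZ n ((k : ZMod n) * t) =
      (((((k * (t.val : ℤ) : ℤ) : ℚ)) / n : ℚ) : AddCircle (1 : ℚ)) := by
  have h : ((k : ZMod n) * t) = ((k * (t.val : ℤ) : ℤ) : ZMod n) := by
    rw [Int.cast_mul, Int.cast_natCast, ZMod.natCast_zmod_val]
  rw [h, zmodToQmodZ_intCast]

/-- **`inv_F (θ, x) = −v(x)·θ(φ)/n ∈ ℚ/ℤ`** for `x ∈ Fˣ`, an unramified character `θ : Γ_F ↠ ℤ/n`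
and the tree's cyclic class `(θ, x) = cyclicClass θ (units F) x ∈ H²(Γ_F, F̄ˣ)`, `inv_F` the Brauer
invariant `brauerInvariantEquiv` (`= inv_n/n` on Kummer images); the sign is that of
`Kummer (κ_n(x) ∪ θ) = −(θ, x)`. [cite: SerreLocalFields1979, XIV §1 Prop. 3; XIII §4 Prop. 13] -/
theorem brauerInvariantEquiv_cyclicClass_of_unramified
    (θ : CyclicCharacter (absoluteGaloisGroup F) n) (hIθ : ∀ σ ∈ absInertia F, θ σ = 0)
    {φ : absoluteGaloisGroup F} (hφ : IsFrobPow φ 1) (x : F) (hx : x ≠ 0) :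
    haveI : CompactSpace (absoluteGaloisGroup F) := absoluteGaloisGroup_compactSpace F
    brauerInvariantEquiv F (cyclicClass θ (units F) (baseUnitsInvariant F x hx)) =
      -(((((ord F x * ((θ φ).val : ℤ) : ℤ) : ℚ)) / n : ℚ) : AddCircle (1 : ℚ)) := by
  haveI : CompactSpace (absoluteGaloisGroup F) := absoluteGaloisGroup_compactSpace F
  -- carrier-typed alias of the Brauer invariant
  let B : continuousCohomology 2 (units F).toTopRep →+ AddCircle (1 : ℚ) :=
    (brauerInvariantEquiv F).toAddMonoidHom
  set cup := ((mu F n).tateDualPairing n).cupProduct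
      ((isSES_kummer F n (NeZero.pos n)).δ₀ (baseUnitsInvariant F x hx))
      (oneCocycleClass _ (scalarCocycle θ)) with hcup
  have h : cohomologyMap (kummerι F n) 2 cup = - cyclicClass θ (units F) (baseUnitsInvariant F x hx) :=
    cohomologyMap_kummerι_cupProduct_δ₀_scalar θ (scalarCocycle θ) (scalarCocycle_apply θ)
      (baseUnitsInvariant F x hx)
  have h' : cyclicClass θ (units F) (baseUnitsInvariant F x hx) = - cohomologyMap (kummerι F n) 2 cup := by
    rw [h, neg_neg]
  change B (cyclicClass θ (units F) (baseUnitsInvariant F x hx)) = _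
  rw [h', map_neg B, neg_inj]
  have hk := brauerInvariantEquiv_kummer (K := F) ⟨n, NeZero.pos n⟩ cup
  change B (cohomologyMap (kummerι F n) 2 cup) =
    (((((invLevel F n cup).val : ℚ)) / (n : ℕ) : ℚ) : AddCircle (1 : ℚ)) at hk
  rw [hk, hcup, invLevel_cupProduct_kummer_scalarCocycle_of_unramified F θ hIθ hφ x hx,
    ← zmodToQmodZ_apply, zmodToQmodZ_intCast_mul]

end Invariant

/-! ### §3. The derived character of a restricted character: `inv_F (χ ∘ ρ, x) = −v(x)·χ(ρ φ)/d` -/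

section Derived

variable (F : Type u) [Field F] [ValuativeRel F] [TopologicalSpace F] [IsNonarchimedeanLocalField F]
  [CharZero F]
variable {G : Type u} [Group G] [TopologicalSpace G] {d : ℕ} [NeZero d]

/-- **Local invariant of a restricted cyclic class.**  Let `χ : G ↠ ℤ/d` be a cyclic character of a
topological group `G`, `ρ : Γ_F → G` a continuous homomorphism such that `χ ∘ ρ` kills the inertia
group of `F` ("`χ` is unramified at `F`"), and `χ' = χ.derived ρ : Γ_F ↠ ℤ/e` the derived character
(`χ ∘ ρ = (d/e) · χ'`; `H²(ρ)(χ, b) = (χ', b)`, `map_cyclicClass_eq_cyclicClass_derived`).  Then for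
`x ∈ Fˣ` and any Frobenius lift `φ`:  `inv_F (χ', x) = −v(x) · χ(ρ φ)/d ∈ ℚ/ℤ`.  This is the local
term at an unramified place of a global cyclic class `(χ, b)` (`G = Γ_K`, `ρ = res_v`).
[cite: SerreLocalFields1979, XIV §1 Prop. 3; XIII §4 Prop. 13] [cite: CasselsFrohlichANT1967, Ch. VII §11] -/
theorem brauerInvariantEquiv_cyclicClass_derived_of_unramified (χ : CyclicCharacter G d)
    (ρ : absoluteGaloisGroup F →ₜ* G) (hI : ∀ σ ∈ absInertia F, χ (ρ σ) = 0)
    {φ : absoluteGaloisGroup F} (hφ : IsFrobPow φ 1) (x : F) (hx : x ≠ 0) :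
    haveI : CompactSpace (absoluteGaloisGroup F) := absoluteGaloisGroup_compactSpace F
    haveI : NeZero (χ.compOrder ρ) := ⟨(χ.compOrder_pos ρ).ne'⟩
    brauerInvariantEquiv F (cyclicClass (χ.derived ρ) (units F) (baseUnitsInvariant F x hx)) =
      -(((((ord F x * ((χ (ρ φ)).val : ℤ) : ℤ) : ℚ)) / d : ℚ) : AddCircle (1 : ℚ)) := by
  haveI : CompactSpace (absoluteGaloisGroup F) := absoluteGaloisGroup_compactSpace F
  haveI : NeZero (χ.compOrder ρ) := ⟨(χ.compOrder_pos ρ).ne'⟩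
  have hI' : ∀ σ ∈ absInertia F, χ.derived ρ σ = 0 := fun σ hσ => by
    rw [← CyclicCharacter.mem_ker, CyclicCharacter.ker_derived, Subgroup.mem_comap,
      CyclicCharacter.mem_ker]
    exact hI σ hσ
  rw [brauerInvariantEquiv_cyclicClass_of_unramified F (χ.derived ρ) hI' hφ x hx, neg_inj,
    χ.val_apply_eq_mul_val_derived ρ φ]
  congr 1
  have he : (χ.compOrder ρ : ℚ) ≠ 0 := Nat.cast_ne_zero.2 (χ.compOrder_pos ρ).ne'
  have hc : (χ.compCofactor ρ : ℚ) ≠ 0 := Nat.cast_ne_zero.2 (χ.compCofactor_pos ρ).ne'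
  have hd : (d : ℚ) = χ.compCofactor ρ * χ.compOrder ρ := by
    rw [← Nat.cast_mul, χ.compCofactor_mul_compOrder ρ]
  rw [hd, div_eq_div_iff he (mul_ne_zero hc he)]
  push_cast
  ring

end Derived

end Literature.NumberTheory.GaloisCohomology

end
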